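import Summits.QuantumFields.BalabanUV.T4Continuum.Support.NE7QbarTopSplitAtPair
import Summits.QuantumFields.BalabanUV.T4Continuum.Support.NE3EnergyWeightedShapes
import Summits.QuantumFields.BalabanUV.T4Continuum.Support.NE3ProductPathBounds
import HarnessLib

/-!
# Support | NE7 (gen 97, ROAD-G97 §4 S4 — THE DIRECT LETTERS OF THE RIGHT-INVERSE ARGUMENT UNDER A TRIVIAL TOP FRAME): at NE7's pair, if the accumulated frame is trivial at the top
# (`v_{j+1} ≡ 1`), the k-fold linearised double-bar average `φ := QbarIter L (j+1) W X` obeys the two DIRECT LETTERS of F326 with k-FREE constants —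
# (DL1) `(M^d∕M⁴)·dirL1 φ [0,N)^d ≤ 64·C1cov·L²d(4L+1)^d·(L^d∕L²)·‖X‖_w²`, (DL2) `(M^d∕M⁴)·dirSq φ [0,N)^d ≤ 1024·K²·(L^d∕L⁴)·(M·b)²·‖X‖_w²` (`‖X‖_w = energyNormW L (j+1) W X [0,N·M)^d`)

Cell `pub-balaban`, rung (B)+1 sub-cell t4, lineage `b2b-balaban-t4-ne7-p1` (CRUX PROVER NE7 #1 = OWNER of row NE7), generation 97; memo `t4/b2b-balaban-t4-ne7-p1-g97/ROAD-G97.md` §4 S4.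
Pure composition of gen 96's entry point `NE7QbarTopSplitAtPair` (`dirL1_QbarIter_sub_topGauge_le`, `sqrt_l2sq_QbarIter_sub_topGauge_le`: `QbarIter X − Ad_{Ū}⁻¹ log((D^{v⁻¹})·D⁻¹)` is k-free
quadratic in ℓ¹∕ℓ²) read at `v ≡ 1` (`gaugeAct 1 D = D`, `mlog 1 = 0`), and the energy-norm bookkeeping `‖X‖_w² ≥ M⁻²·l2sq X` (`NE3EnergyWeightedShapes.energyNormW`).

WHY (memo §4).  On ROAD-Γ′ the right inverse is fed `D(X − spikes) = QbarIter X` ONLY (`NE7TopNormalisedLinearSplit.dirIter_sub_spikes_eq_QbarIter`); after the exact top frame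
normalisation S2 (`v_top ≡ 1`) the top double-bar field vanishes at the pair and `QbarIter X` is row NE3's R26′ remainder; THIS FILE turns that into the two hypotheses (DL1)∕(DL2) of
F326 `NE7RepWGaugeOfDecomposition.decomp_of_directLetters` — with `q₁ = 64·C1cov·L²d(4L+1)^d·L^d∕L²` and `q₂² = 1024K²(L^d∕L⁴)·(Mb)² = C·α̂²`, k-FREE — so that (R1)–(R3) give the
ν- and κ-letters of the `rightInvW` piece of `X_N` exactly as in F326.  The powers of `M` cancel EXACTLY: `(M^d∕M⁴)(L²∕L^d)^j = (L^d∕L²)·M⁻²` and `(M^d∕M⁴)(L⁴∕L^d)^j = L^d∕L⁴`.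
WHAT ([folklore]; 0 def, 0 sorry).  §1 `dirL1_QbarIter_le_of_frameTrivial`, `sqrt_l2sq_QbarIter_le_of_frameTrivial` (TopSplit at `v ≡ 1`).  §2 the power identities and
**`directLetter_L1_of_frameTrivial`** ((DL1)), **`directLetter_L2_of_frameTrivial`** ((DL2)).
HONEST FRAMING (page 1): composition of landed kernel theorems; nothing of Bałaban's asserted; S2 (the existence of a top-normalised representative), the μ-part letters, `hdecomp♭`, NE7 NOT
proved; spine 0∕9; finite T⁴ rung (B)+1 — NOT infinite volume, NOT mass gap, NOT `BetaPertH`, NOT Clay.  Continuum YM on T⁴ ⇐ BetaPertH ∧ nine spine estimates (0/9 proved); BetaPertH ⇐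
(D1) ∧ (D4) ∧ CAP+tail; G-an2-4 gates asym, D1 and NE2/3/4.
-/

set_option autoImplicit false

open scoped BigOperators Matrix Matrix.Norms.L2Operator
open NormedSpace Finset

namespace Summit.QuantumFields.BalabanUV.T4Continuum.NE7TopNormalisedQbarLetters

open Literature.MathematicalPhysics.QuantumFieldTheory.Balaban1983to89
open B7Prop1Explicit B7Prop2Explicit B7Prop3Flat MatrixLog
open T4AveragingDeficitWall (Ad IsUnitaryCfg SmallField vary dirL1 dirSq curlSq)
open T4AveragingDeficitWallBoundary (IsPeriodicCfg periodBox)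
open AveragingDeficitPeriodicCounting (IsPeriodicDir)
open AveragingDeficitMultiLevelPrep (cavgIter LevelSmall)
open AveragingDeficitNearIdentity (Ad_zero)
open B7Eq92Concrete (vcov)
open NE3TangentCovariantTower (QbarIter)
open NE3CovariantLineSumsL2 (l2sq l2sq_nonneg)
open NE3.PairLandauB8Avg (relPert)
open ReplicationRightInverseBound (radSum)
open BlockAverageVaryHolo (nbRad)
open NE3CovariantLineSumsError (Csup)
open ShellMeasureAverageProp4General (C1cov C1cov_pos)
open BlockAveragePushDirGauge (gaugeAct_const_one)
open NE3EnergyWeightedShapes (energyNormW energyNormW_nonneg)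
open NE3ProductPathBounds (energySq_nonneg)
open NE3EnergyHessContTwoTerm (curlSq_nonneg dirSq_nonneg)
open NE7QbarTopSplitAtPair (dirL1_QbarIter_sub_topGauge_le sqrt_l2sq_QbarIter_sub_topGauge_le)

noncomputable section

variable {d : ℕ} {n : Type*} [Fintype n] [DecidableEq n]

/-! ## §1 The entry point read at a trivial top frame -/

/-- With `v ≡ 1` the subtracted top pure gauge vanishes: `Ad u⁻¹ (mlog ((gaugeAct v⁻¹ D) z κ · (D z κ)⁻¹)) = 0`. [folklore] -/
theorem topGauge_eq_zero_of_frameTrivial {v : Site d → (Matrix n n ℂ)ˣ} (hv1 : ∀ z, v z = 1) (D : Site d → Fin d → (Matrix n n ℂ)ˣ) (u : (Matrix n n ℂ)ˣ)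
    (z : Site d) (κ : Fin d) :
    Ad u⁻¹ (mlog ((gaugeAct v⁻¹ D z κ * (D z κ)⁻¹ : (Matrix n n ℂ)ˣ) : Matrix n n ℂ)) = 0 := by
  have hv : v⁻¹ = fun _ : Site d => (1 : (Matrix n n ℂ)ˣ) := by funext y; rw [Pi.inv_apply, hv1 y, inv_one]
  rw [hv, gaugeAct_const_one, mul_inv_cancel, Units.val_one, mlog_one, Ad_zero]

/-- **(Γ1)-ℓ¹ AT A TRIVIAL TOP FRAME**: hypotheses of `NE7QbarTopSplitAtPair.dirL1_QbarIter_sub_topGauge_le` plus `v_{j+1} ≡ 1` ⟹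
`dirL1 (QbarIter L (j+1) W X) [0,N)^d ≤ 64C₁L²d(4L+1)^d·((L∕L^d)L)^j·l2sq X` — row NE3's R26′ verbatim. [folklore] -/
theorem dirL1_QbarIter_le_of_frameTrivial [Nonempty n] {L N : ℕ} (hL : 2 ≤ L) (hN : 1 ≤ N) (j : ℕ)
    {W UA D : Site d → Fin d → (Matrix n n ℂ)ˣ} {u : Site d → (Matrix n n ℂ)ˣ} {x : ℝ} (hWu : IsUnitaryCfg W) (hWP : IsPeriodicCfg W ((N * L ^ (j + 1) : ℕ) : ℤ))
    (hx : 0 ≤ x) (hsm : LevelSmall d L j x) (hWx : SmallField W x)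
    {α₀ b : ℝ} (hα : 0 < α₀) (hα3 : C0 d * (2 * α₀) ≤ 1 / 3) (hα4 : 4 * (2 * α₀) ≤ c2' d L)
    (h52 : pdev W < α₀ * (((L : ℝ) ^ (j + 1))⁻¹) ^ 2) (hb : 0 ≤ b)
    {X : Site d → Fin d → Matrix n n ℂ} (hX : ∀ (y : Site d) (κ : Fin d), ‖X y κ‖ ≤ b) (hXP : IsPeriodicDir X ((N * L ^ (j + 1) : ℕ) : ℤ))
    (hsmall : Real.exp (4 * (800 * ((d : ℝ) + 1) ^ 2 * ((d : ℝ) + 4)) * α₀)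
      * (1 + 8 * (131072 * ((d : ℝ) + 1) ^ 2) * ((L : ℝ) ^ (j + 1) * b)) ≤ 2)
    (hc₃ : 4 * ((L : ℝ) ^ (j + 1) * b) ≤ c3 d L)
    (hK : 16 * (C1cov d * (L : ℝ) ^ 2 * Real.sqrt (d * (2 * (2 * L) + 1) ^ d)) * (L : ℝ) ^ (j + 1) * b ≤ Real.sqrt ((L : ℝ) ^ 2 / (L : ℝ) ^ d))
    (hS1 : (16 * (d + 1) * (d + 4) * (L : ℝ) ^ 2 * Csup d L * (d * (2 * nbRad d L + 1) ^ d)) * radSum d L j x ≤ ((L : ℝ) / (L : ℝ) ^ d) / 2)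
    (hrep : gaugeAct u UA = vary W X 1) (hcorner : ∀ z : Site d, u (((L : ℤ) ^ (j + 1)) • z) = 1)
    (hA : avgIter L UA (j + 1) = D) (hW : avgIter L W (j + 1) = D)
    (hv1 : ∀ z : Site d, vcov L W (relPert W X) (j + 1) z = 1) :
    dirL1 (QbarIter L (j + 1) W X) (periodBox (d := d) N)
      ≤ 64 * (C1cov d * (L : ℝ) ^ 2 * (d * (2 * (2 * (L : ℝ)) + 1) ^ d)) * (((L : ℝ) / (L : ℝ) ^ d) * L) ^ (j + 1 - 1)
          * l2sq (periodBox (d := d) (N * L ^ (j + 1))) X := by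
  have h := dirL1_QbarIter_sub_topGauge_le hL hN j hWu hWP hx hsm hWx hα hα3 hα4 h52 hb hX hXP hsmall hc₃ hK hS1 hrep hcorner hA hW
  have e : (fun z κ => QbarIter L (j + 1) W X z κ
        - Ad ((cavgIter L (j + 1) W) z κ)⁻¹ (mlog ((gaugeAct (vcov L W (relPert W X) (j + 1))⁻¹ D z κ * (D z κ)⁻¹ : (Matrix n n ℂ)ˣ) : Matrix n n ℂ)))
      = QbarIter L (j + 1) W X := by
    funext z κ; rw [topGauge_eq_zero_of_frameTrivial hv1, sub_zero]
  rw [e] at h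
  exact h

/-- **(Γ1)-ℓ² AT A TRIVIAL TOP FRAME**: `√l2sq [0,N)^d (QbarIter L (j+1) W X) ≤ 32C₁L²√(d(4L+1)^d)·√l2sq X·b·(√(L²∕L^d)L)^j`. [folklore] -/
theorem sqrt_l2sq_QbarIter_le_of_frameTrivial [Nonempty n] {L N : ℕ} (hL : 2 ≤ L) (hN : 1 ≤ N) (j : ℕ)
    {W UA D : Site d → Fin d → (Matrix n n ℂ)ˣ} {u : Site d → (Matrix n n ℂ)ˣ} {x : ℝ} (hWu : IsUnitaryCfg W) (hWP : IsPeriodicCfg W ((N * L ^ (j + 1) : ℕ) : ℤ))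
    (hx : 0 ≤ x) (hsm : LevelSmall d L j x) (hWx : SmallField W x)
    {α₀ b : ℝ} (hα : 0 < α₀) (hα3 : C0 d * (2 * α₀) ≤ 1 / 3) (hα4 : 4 * (2 * α₀) ≤ c2' d L)
    (h52 : pdev W < α₀ * (((L : ℝ) ^ (j + 1))⁻¹) ^ 2) (hb : 0 ≤ b)
    {X : Site d → Fin d → Matrix n n ℂ} (hX : ∀ (y : Site d) (κ : Fin d), ‖X y κ‖ ≤ b) (hXP : IsPeriodicDir X ((N * L ^ (j + 1) : ℕ) : ℤ))
    (hsmall : Real.exp (4 * (800 * ((d : ℝ) + 1) ^ 2 * ((d : ℝ) + 4)) * α₀)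
      * (1 + 8 * (131072 * ((d : ℝ) + 1) ^ 2) * ((L : ℝ) ^ (j + 1) * b)) ≤ 2)
    (hc₃ : 4 * ((L : ℝ) ^ (j + 1) * b) ≤ c3 d L)
    (hK : 16 * (C1cov d * (L : ℝ) ^ 2 * Real.sqrt (d * (2 * (2 * L) + 1) ^ d)) * (L : ℝ) ^ (j + 1) * b ≤ Real.sqrt ((L : ℝ) ^ 2 / (L : ℝ) ^ d))
    (hrep : gaugeAct u UA = vary W X 1) (hcorner : ∀ z : Site d, u (((L : ℤ) ^ (j + 1)) • z) = 1)
    (hA : avgIter L UA (j + 1) = D) (hW : avgIter L W (j + 1) = D)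
    (hv1 : ∀ z : Site d, vcov L W (relPert W X) (j + 1) z = 1) :
    Real.sqrt (l2sq (periodBox (d := d) N) (QbarIter L (j + 1) W X))
      ≤ 32 * (C1cov d * (L : ℝ) ^ 2 * Real.sqrt (d * (2 * (2 * L) + 1) ^ d))
          * Real.sqrt (l2sq (periodBox (d := d) (N * L ^ (j + 1))) X) * b * (Real.sqrt ((L : ℝ) ^ 2 / (L : ℝ) ^ d) * L) ^ (j + 1 - 1) := by
  have h := sqrt_l2sq_QbarIter_sub_topGauge_le hL hN j hWu hWP hx hsm hWx hα hα3 hα4 h52 hb hX hXP hsmall hc₃ hK hrep hcorner hA hW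
  have e : (fun z κ => QbarIter L (j + 1) W X z κ
        - Ad ((cavgIter L (j + 1) W) z κ)⁻¹ (mlog ((gaugeAct (vcov L W (relPert W X) (j + 1))⁻¹ D z κ * (D z κ)⁻¹ : (Matrix n n ℂ)ˣ) : Matrix n n ℂ)))
      = QbarIter L (j + 1) W X := by
    funext z κ; rw [topGauge_eq_zero_of_frameTrivial hv1, sub_zero]
  rw [e] at h
  exact h

/-! ## §2 The two direct letters against the weighted energy norm -/

omit [Fintype n] [DecidableEq n] in
/-- `(M^d∕M⁴)·((L∕L^d)·L)^j = (L^d∕L²)·M⁻²` for `M = L^{j+1}`, `L > 0`. [folklore] -/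
theorem pow_identity_L1 {L : ℝ} (hL : 0 < L) (j : ℕ) :
    (L ^ (j + 1)) ^ d / (L ^ (j + 1)) ^ 4 * ((L / L ^ d) * L) ^ (j + 1 - 1) = L ^ d / L ^ 2 * ((L ^ (j + 1)) ^ 2)⁻¹ := by
  rw [Nat.add_sub_cancel]
  have hL0 : L ≠ 0 := ne_of_gt hL
  have hA : (L ^ d) ^ j ≠ 0 := by positivity
  have hB : (L ^ (j + 1)) ^ 2 ≠ 0 := by positivity
  have hLd : L ^ d ≠ 0 := by positivity
  have hL2 : L ^ 2 ≠ 0 := by positivity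
  have hM : (L ^ (j + 1)) ^ d = (L ^ d) ^ j * L ^ d := by
    rw [pow_succ L j, mul_pow, ← pow_mul, mul_comm j d, pow_mul]
  have hP : (L / L ^ d * L) ^ j = (L ^ 2) ^ j / (L ^ d) ^ j := by
    rw [← div_pow]; congr 1; field_simp
  have h4 : (L ^ (j + 1)) ^ 4 = (L ^ (j + 1)) ^ 2 * (L ^ (j + 1)) ^ 2 := by rw [← pow_add]
  have key : (L ^ (j + 1)) ^ 2 = (L ^ 2) ^ j * L ^ 2 := by
    rw [← pow_mul, mul_comm (j + 1) 2, pow_mul, pow_succ]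
  rw [hM, hP, h4, key]
  field_simp

omit [Fintype n] [DecidableEq n] in
/-- `(M^d∕M⁴)·((√(L²∕L^d)·L)^j)² = L^d∕L⁴` for `M = L^{j+1}`, `L > 0`. [folklore] -/
theorem pow_identity_L2 {L : ℝ} (hL : 0 < L) (j : ℕ) :
    (L ^ (j + 1)) ^ d / (L ^ (j + 1)) ^ 4 * ((Real.sqrt (L ^ 2 / L ^ d) * L) ^ (j + 1 - 1)) ^ 2 = L ^ d / L ^ 4 := by
  rw [Nat.add_sub_cancel]
  have hL0 : L ≠ 0 := ne_of_gt hL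
  have hA : (L ^ d) ^ j ≠ 0 := by positivity
  have hLd : L ^ d ≠ 0 := by positivity
  have hL4 : L ^ 4 ≠ 0 := by positivity
  have hC : (L ^ 4) ^ j ≠ 0 := by positivity
  have e1 : ((Real.sqrt (L ^ 2 / L ^ d) * L) ^ j) ^ 2 = ((Real.sqrt (L ^ 2 / L ^ d) * L) ^ 2) ^ j := by
    rw [← pow_mul, ← pow_mul, Nat.mul_comm j 2]
  have e2 : (Real.sqrt (L ^ 2 / L ^ d) * L) ^ 2 = L ^ 4 / L ^ d := by
    rw [mul_pow, Real.sq_sqrt (by positivity), div_mul_eq_mul_div]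
    congr 1; ring
  have hM : (L ^ (j + 1)) ^ d = (L ^ d) ^ j * L ^ d := by
    rw [pow_succ L j, mul_pow, ← pow_mul, mul_comm j d, pow_mul]
  have hM4 : (L ^ (j + 1)) ^ 4 = (L ^ 4) ^ j * L ^ 4 := by
    rw [pow_succ L j, mul_pow, ← pow_mul, mul_comm j 4, pow_mul]
  rw [e1, e2, div_pow, hM, hM4]
  field_simp

/-- `M⁻²·l2sq X ≤ ‖X‖_w²`. [folklore] -/
theorem inv_sq_mul_l2sq_le_energySq (L : ℕ) (j : ℕ) (W : Site d → Fin d → (Matrix n n ℂ)ˣ) (X : Site d → Fin d → Matrix n n ℂ) (F : Finset (Site d)) :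
    (((L : ℝ) ^ (j + 1)) ^ 2)⁻¹ * l2sq F X ≤ energyNormW L (j + 1) W X F ^ 2 := by
  unfold energyNormW
  rw [Real.sq_sqrt (energySq_nonneg L (j + 1) W X F)]
  have hc := curlSq_nonneg W X F
  have e : (((L : ℝ) ^ (j + 1)) ^ 2)⁻¹ * l2sq F X = (((L : ℝ) ^ (j + 1))⁻¹) ^ 2 * dirSq X F := by rw [inv_pow]; rfl
  rw [e]; linarith

/-- **(DL1) UNDER A TRIVIAL TOP FRAME**: `(M^d∕M⁴)·dirL1 (QbarIter L (j+1) W X) [0,N)^d ≤ (64·C1cov·L²d(4L+1)^d·(L^d∕L²))·‖X‖_w²`, `‖X‖_w = energyNormW L (j+1) W X [0,N·M)^d` — the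
k-FREE `q₁` of F326. [folklore] -/
theorem directLetter_L1_of_frameTrivial [Nonempty n] {L N : ℕ} (hL : 2 ≤ L) (hN : 1 ≤ N) (j : ℕ)
    {W UA D : Site d → Fin d → (Matrix n n ℂ)ˣ} {u : Site d → (Matrix n n ℂ)ˣ} {x : ℝ} (hWu : IsUnitaryCfg W) (hWP : IsPeriodicCfg W ((N * L ^ (j + 1) : ℕ) : ℤ))
    (hx : 0 ≤ x) (hsm : LevelSmall d L j x) (hWx : SmallField W x)
    {α₀ b : ℝ} (hα : 0 < α₀) (hα3 : C0 d * (2 * α₀) ≤ 1 / 3) (hα4 : 4 * (2 * α₀) ≤ c2' d L)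
    (h52 : pdev W < α₀ * (((L : ℝ) ^ (j + 1))⁻¹) ^ 2) (hb : 0 ≤ b)
    {X : Site d → Fin d → Matrix n n ℂ} (hX : ∀ (y : Site d) (κ : Fin d), ‖X y κ‖ ≤ b) (hXP : IsPeriodicDir X ((N * L ^ (j + 1) : ℕ) : ℤ))
    (hsmall : Real.exp (4 * (800 * ((d : ℝ) + 1) ^ 2 * ((d : ℝ) + 4)) * α₀)
      * (1 + 8 * (131072 * ((d : ℝ) + 1) ^ 2) * ((L : ℝ) ^ (j + 1) * b)) ≤ 2)
    (hc₃ : 4 * ((L : ℝ) ^ (j + 1) * b) ≤ c3 d L)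
    (hK : 16 * (C1cov d * (L : ℝ) ^ 2 * Real.sqrt (d * (2 * (2 * L) + 1) ^ d)) * (L : ℝ) ^ (j + 1) * b ≤ Real.sqrt ((L : ℝ) ^ 2 / (L : ℝ) ^ d))
    (hS1 : (16 * (d + 1) * (d + 4) * (L : ℝ) ^ 2 * Csup d L * (d * (2 * nbRad d L + 1) ^ d)) * radSum d L j x ≤ ((L : ℝ) / (L : ℝ) ^ d) / 2)
    (hrep : gaugeAct u UA = vary W X 1) (hcorner : ∀ z : Site d, u (((L : ℤ) ^ (j + 1)) • z) = 1)
    (hA : avgIter L UA (j + 1) = D) (hW : avgIter L W (j + 1) = D)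
    (hv1 : ∀ z : Site d, vcov L W (relPert W X) (j + 1) z = 1) :
    ((L : ℝ) ^ (j + 1)) ^ d / ((L : ℝ) ^ (j + 1)) ^ 4 * dirL1 (QbarIter L (j + 1) W X) (periodBox (d := d) N)
      ≤ (64 * (C1cov d * (L : ℝ) ^ 2 * (d * (2 * (2 * (L : ℝ)) + 1) ^ d)) * ((L : ℝ) ^ d / (L : ℝ) ^ 2))
          * energyNormW L (j + 1) W X (periodBox (d := d) (N * L ^ (j + 1))) ^ 2 := by
  have hL0 : (0 : ℝ) < L := by exact_mod_cast (show 0 < L by omega)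
  have h := dirL1_QbarIter_le_of_frameTrivial hL hN j hWu hWP hx hsm hWx hα hα3 hα4 h52 hb hX hXP hsmall hc₃ hK hS1 hrep hcorner hA hW hv1
  set K₁ : ℝ := 64 * (C1cov d * (L : ℝ) ^ 2 * (d * (2 * (2 * (L : ℝ)) + 1) ^ d)) with hK₁
  have hK₁0 : 0 ≤ K₁ := by rw [hK₁]; have := C1cov_pos d; positivity
  set E2 : ℝ := energyNormW L (j + 1) W X (periodBox (d := d) (N * L ^ (j + 1))) ^ 2 with hE2
  have hMd0 : 0 ≤ ((L : ℝ) ^ (j + 1)) ^ d / ((L : ℝ) ^ (j + 1)) ^ 4 := by positivity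
  have hEn := inv_sq_mul_l2sq_le_energySq L j W X (periodBox (d := d) (N * L ^ (j + 1)))
  calc ((L : ℝ) ^ (j + 1)) ^ d / ((L : ℝ) ^ (j + 1)) ^ 4 * dirL1 (QbarIter L (j + 1) W X) (periodBox (d := d) N)
      ≤ ((L : ℝ) ^ (j + 1)) ^ d / ((L : ℝ) ^ (j + 1)) ^ 4 * (K₁ * (((L : ℝ) / (L : ℝ) ^ d) * L) ^ (j + 1 - 1) * l2sq (periodBox (d := d) (N * L ^ (j + 1))) X) :=
        mul_le_mul_of_nonneg_left h hMd0
    _ = K₁ * (((L : ℝ) ^ (j + 1)) ^ d / ((L : ℝ) ^ (j + 1)) ^ 4 * (((L : ℝ) / (L : ℝ) ^ d) * L) ^ (j + 1 - 1)) * l2sq (periodBox (d := d) (N * L ^ (j + 1))) X := by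
        ring
    _ = K₁ * ((L : ℝ) ^ d / (L : ℝ) ^ 2 * (((L : ℝ) ^ (j + 1)) ^ 2)⁻¹) * l2sq (periodBox (d := d) (N * L ^ (j + 1))) X := by
        rw [pow_identity_L1 (d := d) hL0 j]
    _ = K₁ * ((L : ℝ) ^ d / (L : ℝ) ^ 2) * ((((L : ℝ) ^ (j + 1)) ^ 2)⁻¹ * l2sq (periodBox (d := d) (N * L ^ (j + 1))) X) := by ring
    _ ≤ K₁ * ((L : ℝ) ^ d / (L : ℝ) ^ 2) * E2 := mul_le_mul_of_nonneg_left hEn (by positivity)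

/-- **(DL2) UNDER A TRIVIAL TOP FRAME**: `(M^d∕M⁴)·dirSq (QbarIter L (j+1) W X) [0,N)^d ≤ (1024·K²·(L^d∕L⁴)·(M·b)²)·‖X‖_w²`, `K = C1cov·L²√(d(4L+1)^d)` — F326's `q₂² = C·α̂²`, k-FREE.
[folklore] -/
theorem directLetter_L2_of_frameTrivial [Nonempty n] {L N : ℕ} (hL : 2 ≤ L) (hN : 1 ≤ N) (j : ℕ)
    {W UA D : Site d → Fin d → (Matrix n n ℂ)ˣ} {u : Site d → (Matrix n n ℂ)ˣ} {x : ℝ} (hWu : IsUnitaryCfg W) (hWP : IsPeriodicCfg W ((N * L ^ (j + 1) : ℕ) : ℤ))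
    (hx : 0 ≤ x) (hsm : LevelSmall d L j x) (hWx : SmallField W x)
    {α₀ b : ℝ} (hα : 0 < α₀) (hα3 : C0 d * (2 * α₀) ≤ 1 / 3) (hα4 : 4 * (2 * α₀) ≤ c2' d L)
    (h52 : pdev W < α₀ * (((L : ℝ) ^ (j + 1))⁻¹) ^ 2) (hb : 0 ≤ b)
    {X : Site d → Fin d → Matrix n n ℂ} (hX : ∀ (y : Site d) (κ : Fin d), ‖X y κ‖ ≤ b) (hXP : IsPeriodicDir X ((N * L ^ (j + 1) : ℕ) : ℤ))
    (hsmall : Real.exp (4 * (800 * ((d : ℝ) + 1) ^ 2 * ((d : ℝ) + 4)) * α₀)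
      * (1 + 8 * (131072 * ((d : ℝ) + 1) ^ 2) * ((L : ℝ) ^ (j + 1) * b)) ≤ 2)
    (hc₃ : 4 * ((L : ℝ) ^ (j + 1) * b) ≤ c3 d L)
    (hK : 16 * (C1cov d * (L : ℝ) ^ 2 * Real.sqrt (d * (2 * (2 * L) + 1) ^ d)) * (L : ℝ) ^ (j + 1) * b ≤ Real.sqrt ((L : ℝ) ^ 2 / (L : ℝ) ^ d))
    (hrep : gaugeAct u UA = vary W X 1) (hcorner : ∀ z : Site d, u (((L : ℤ) ^ (j + 1)) • z) = 1)
    (hA : avgIter L UA (j + 1) = D) (hW : avgIter L W (j + 1) = D)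
    (hv1 : ∀ z : Site d, vcov L W (relPert W X) (j + 1) z = 1) :
    ((L : ℝ) ^ (j + 1)) ^ d / ((L : ℝ) ^ (j + 1)) ^ 4 * dirSq (QbarIter L (j + 1) W X) (periodBox (d := d) N)
      ≤ (1024 * (C1cov d * (L : ℝ) ^ 2 * Real.sqrt (d * (2 * (2 * L) + 1) ^ d)) ^ 2 * ((L : ℝ) ^ d / (L : ℝ) ^ 4) * ((L : ℝ) ^ (j + 1) * b) ^ 2)
          * energyNormW L (j + 1) W X (periodBox (d := d) (N * L ^ (j + 1))) ^ 2 := by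
  have hL0 : (0 : ℝ) < L := by exact_mod_cast (show 0 < L by omega)
  have h := sqrt_l2sq_QbarIter_le_of_frameTrivial hL hN j hWu hWP hx hsm hWx hα hα3 hα4 h52 hb hX hXP hsmall hc₃ hK hrep hcorner hA hW hv1
  set K : ℝ := C1cov d * (L : ℝ) ^ 2 * Real.sqrt (d * (2 * (2 * L) + 1) ^ d) with hKdef
  have hK0 : 0 ≤ K := by rw [hKdef]; have := C1cov_pos d; positivity
  set ρ : ℝ := Real.sqrt ((L : ℝ) ^ 2 / (L : ℝ) ^ d) with hρ
  set EX : ℝ := l2sq (periodBox (d := d) (N * L ^ (j + 1))) X with hEX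
  have hEX0 : 0 ≤ EX := l2sq_nonneg _ _
  set E2 : ℝ := energyNormW L (j + 1) W X (periodBox (d := d) (N * L ^ (j + 1))) ^ 2 with hE2
  -- square the ℓ² letter: `dirSq (QbarIter X) = l2sq ≤ (32K·√EX·b·(ρL)^j)²`
  have h0 : 0 ≤ l2sq (periodBox (d := d) N) (QbarIter L (j + 1) W X) := l2sq_nonneg _ _
  have hsq : dirSq (QbarIter L (j + 1) W X) (periodBox (d := d) N) ≤ (32 * K * Real.sqrt EX * b * (ρ * L) ^ (j + 1 - 1)) ^ 2 := by
    have h1 := pow_le_pow_left₀ (Real.sqrt_nonneg _) h 2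
    rw [Real.sq_sqrt h0] at h1
    exact h1
  have hMd0 : 0 ≤ ((L : ℝ) ^ (j + 1)) ^ d / ((L : ℝ) ^ (j + 1)) ^ 4 := by positivity
  have hEn := inv_sq_mul_l2sq_le_energySq L j W X (periodBox (d := d) (N * L ^ (j + 1)))
  have hid := pow_identity_L2 (d := d) hL0 j
  calc ((L : ℝ) ^ (j + 1)) ^ d / ((L : ℝ) ^ (j + 1)) ^ 4 * dirSq (QbarIter L (j + 1) W X) (periodBox (d := d) N)
      ≤ ((L : ℝ) ^ (j + 1)) ^ d / ((L : ℝ) ^ (j + 1)) ^ 4 * (32 * K * Real.sqrt EX * b * (ρ * L) ^ (j + 1 - 1)) ^ 2 := mul_le_mul_of_nonneg_left hsq hMd0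
    _ = 1024 * K ^ 2 * (((L : ℝ) ^ (j + 1)) ^ d / ((L : ℝ) ^ (j + 1)) ^ 4 * ((ρ * L) ^ (j + 1 - 1)) ^ 2) * b ^ 2 * Real.sqrt EX ^ 2 := by ring
    _ = 1024 * K ^ 2 * ((L : ℝ) ^ d / (L : ℝ) ^ 4) * b ^ 2 * EX := by rw [hid, Real.sq_sqrt hEX0]
    _ = 1024 * K ^ 2 * ((L : ℝ) ^ d / (L : ℝ) ^ 4) * ((L : ℝ) ^ (j + 1) * b) ^ 2 * ((((L : ℝ) ^ (j + 1)) ^ 2)⁻¹ * EX) := by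
        have hM0 : ((L : ℝ) ^ (j + 1)) ^ 2 ≠ 0 := by positivity
        field_simp
    _ ≤ 1024 * K ^ 2 * ((L : ℝ) ^ d / (L : ℝ) ^ 4) * ((L : ℝ) ^ (j + 1) * b) ^ 2 * E2 := mul_le_mul_of_nonneg_left hEn (by positivity)

end

end Summit.QuantumFields.BalabanUV.T4Continuum.NE7TopNormalisedQbarLetters
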